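import Summits.QuantumFields.QCD.Theses.SpectralDefectExtinction
import Literature.Barriers.QuantumFields.WilsonDeterminantSign
import Literature.MathematicalPhysics.QuantumLattice.OverlapLocality
import Literature.MathematicalPhysics.QuantumLattice.WilsonDiracRangeOne
import Literature.MathematicalPhysics.QuantumFieldTheory.QCD
import Summits.QuantumFields.QCD.Theorems.SpectralDefectExtinctionExtinctionBuildsQCDStubWindowModesLocalisedAux
import Summits.QuantumFields.QCD.Theorems.SpectralDefectExtinctionExtinctionBuildsQCDStubWindowModesLocalisedAux3
import Summits.QuantumFields.QCD.Theorems.SpectralDefectExtinctionExtinctionBuildsQCDStubWindowModesLocalisedAux5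

/-!
# Stub W3 `stub_windowModesLocalised` of line `block-away-the-sign`
(crux `Summit.QuantumFields.QCD.Theses.SpectralDefectExtinction.ExtinctionBuildsQCD`, item stmt-QuantumFields-18064)

**Window modes of `Γ₅ D_W` live on a well set counted by the window itself** — the Wilson specialisation of the
sparse-window-wells module, registered as `(W1: min–max well budget) → (W2: abstract Agmon estimate) →
(localisation)`, with absolute constants `A = 9⁴·4⁴·401⁴`, `κ₁ = 1/768`.

Proof.  Fix `U`, `m₀`, the window `0 < w ≤ 1` and `θ ∈ (0, 1/3)`; levels `E₁ = (1−θ)w` (bad-box test),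
`E₂ = (1 − 3θ/2)w` (outer floor), `E₀ = (1−2θ)w` (eigenvectors to localise); block side `r = ⌈400/(√θ·w)⌉`.
If the torus side `2S+1` is `< 2r` a single patch (the whole torus, `χ ≡ 1`, `D = 0`) is used; otherwise the
patch system of `…Aux3` on `(ZMod (2S+1))⁴` with `n = ⌊(2S+1)/r⌋ ≥ 2` blocks per direction (`D = 8/r²`,
`M = 9⁴`, `Bmax = (4r)⁴`), for which the numerical gap `D(96 + 96²) ≤ E₁² − E₂²` holds by the choice of `r`.
The assembly `…Aux5` (budget `…Aux4` from W1, IMS outer floor `…Aux`, decay from W2 with rate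
`(E₂ − E₀)/768 = θw/1536`) then yields `R` with `|R| ≤ 9⁴(4r)⁴·N(E₁) ≤ A/(θ²w⁴)·N(w)` and the decay
`Σ_{dist(p,R) ≥ d} ‖ψ_p‖² ≤ 300 e^{−θ w d/768} ‖ψ‖²`.

References (prose): Agmon, *Lectures on exponential decay of solutions of second-order elliptic equations*
(Princeton Math. Notes 29, 1982); Cycon–Froese–Kirsch–Simon, *Schrödinger operators* (1987) §3.1 (IMS
localisation); Combes–Thomas, Comm. Math. Phys. 34 (1973) 251.
-/

noncomputable section

namespace Summit.QuantumFields.QCD.Cruxes.ExtinctionBuildsQCD.BlockAwayTheSign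

open scoped BigOperators Topology Classical MeasureTheory Matrix
open Filter MeasureTheory Matrix
open Literature.MathematicalPhysics.QuantumLattice Literature.MathematicalPhysics.AQFT
  Literature.MathematicalPhysics.QuantumFieldTheory Literature.Probability.LatticeModels
open Literature.Barriers.QuantumFields.WilsonDeterminant
open Summit.QuantumFields.QCD.Theses.SpectralDefectExtinction
open Summit.QuantumFields.QCD.Theses

/-- **Stub W3 (`stub_windowModesLocalised`) — window modes of `Γ₅D_W` live on a well set counted by
the window itself (Wilson specialisation: W1 + W2 + IMS patching; absolute constants `A, κ₁`).** For
every `SU(3)` field `U` on the four-torus of side `2S+1`, bare mass `m₀`, window `0 < w ≤ 1` and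
`θ ∈ (0, 1/3)`: with `H = Γ₅ D_W(U, m₀, 1)` and `N` the number of its eigenvalues in `(−w, w)` there is a
set `R` of at most `A/(θ²w⁴) · N` sites such that every eigenvector with `|λ| ≤ (1 − 2θ)w` has at most
`A e^{−κ₁ θ w d}` of its `ℓ²` mass at taxi distance `≥ d` from `R` — given the min–max well budget (W1) and the
abstract Agmon estimate (W2). -/
theorem stub_windowModesLocalised : (∀ {ι : Type} [Fintype ι] [DecidableEq ι] {H : Matrix ι ι ℂ}, H.IsHermitian → ∀ (E : ℝ), 0 < E → ∀ {k : ℕ} (φ : Fin k → ι → ℂ), (∀ a b, a ≠ b → ∀ i, φ a i = 0 ∨ φ b i = 0) → (∀ a b, a ≠ b → star (H *ᵥ φ a) ⬝ᵥ (H *ᵥ φ b) = 0) → (∀ a, ∑ i, ‖(H *ᵥ φ a) i‖ ^ 2 < E ^ 2 * ∑ i, ‖φ a i‖ ^ 2) → k ≤ H.charpoly.roots.countP (fun z => |z.re| < E)) → (∀ {ι : Type} [Fintype ι] [DecidableEq ι] (dist : ι → ι → ℕ), (∀ i, dist i i = 0) → (∀ i j, dist i j = dist j i) → (∀ i j l,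 dist i l ≤ dist i j + dist j l) → ∀ (A : Matrix ι ι ℂ), (∀ i j, A i j ≠ 0 → dist i j ≤ 1) → ∀ (h : ℝ), (∀ i, ∑ j ∈ Finset.univ.filter (fun j => dist i j ≠ 0), ‖A i j‖ ≤ h) → (∀ j, ∑ i ∈ Finset.univ.filter (fun i => dist i j ≠ 0), ‖A i j‖ ≤ h) → ∀ (ρ : ι → ℕ), (∀ i j, (ρ i : ℤ) - ρ j ≤ dist i j) → ∀ (E₀ g : ℝ), 0 < g → ∀ (r₀ : ℕ), (∀ lam : ℝ, |lam| ≤ E₀ → ∀ v : ι → ℂ, (∀ i, ρ i < r₀ → v i = 0) → g ^ 2 * ∑ i, ‖v i‖ ^ 2 ≤ ∑ i, ‖((A - (lam : ℂ) • (1 : Matrix ι ι ℂ)) *ᵥ v) i‖ ^ 2) → ∀ (κ : ℝ), 0 ≤ κ → h * (Real.exp κ - 1) ≤ g / 4 → ∀ (lam : ℝ) (ψ : ι → ℂ), |lam| ≤ E₀ → A *ᵥ ψ = (lam : ℂ) • ψ → ∀ d : ℕ, ∑ i ∈ Finset.univ.filter (fun i => r₀ + d ≤ ρ i), ‖ψ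 i‖ ^ 2 ≤ 100 * Real.exp (-(2 * κ * (d : ℝ))) * ∑ i, ‖ψ i‖ ^ 2) → ∃ A κ₁ : ℝ, 0 < A ∧ 0 < κ₁ ∧ ∀ {S : ℕ} (U : GaugeConfig 4 (2 * S + 1) SU3) (m₀ w θ : ℝ), 0 < w → w ≤ 1 → 0 < θ → θ < 1 / 3 → ∃ R : Finset (TorusSite 4 (2 * S + 1)), (R.card : ℝ) ≤ A / (θ ^ 2 * w ^ 4) * ((hermitianWilsonDirac (fundamentalRep (Fin 3)) U m₀ 1).charpoly.roots.countP (fun z => |z.re| < w) : ℝ) ∧ ∀ (lam : ℝ) (ψ : Idx (2 * S + 1) 3 → ℂ), |lam| ≤ (1 - 2 * θ) * w → hermitianWilsonDirac (fundamentalRep (Fin 3)) U m₀ 1 *ᵥ ψ = (lam : ℂ) • ψ → ∀ d : ℕ, ∑ p ∈ Finset.univ.filter (fun p : Idx (2 * S + 1) 3 => ∀ x ∈ R, d ≤ torusTaxiDist p.1 x), ‖ψ p‖ ^ 2 ≤ A * Real.exp (-(κ₁ * θ * w * d)) * ∑ p, ‖ψ p‖ ^ 2 := by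
  intro hW1 hW2
  refine ⟨(9 : ℝ) ^ 4 * 4 ^ 4 * 401 ^ 4, 1 / 768, by positivity, by norm_num, ?_⟩
  intro S U m₀ w θ hw hw1 hθ hθ3
  -- the levels
  set E₁ : ℝ := (1 - θ) * w with hE₁def
  set E₂ : ℝ := (1 - 3 / 2 * θ) * w with hE₂def
  set E₀ : ℝ := (1 - 2 * θ) * w with hE₀def
  have hE₁ : 0 < E₁ := by rw [hE₁def]; nlinarith
  have hE₀ : 0 ≤ E₀ := by rw [hE₀def]; nlinarith
  have hE₀₂ : E₀ < E₂ := by rw [hE₀def, hE₂def]; nlinarith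
  have hE₂1 : E₂ ≤ 1 := by rw [hE₂def]; nlinarith
  have hE20 : E₂ - E₀ = θ * w / 2 := by rw [hE₂def, hE₀def]; ring
  have hE12 : E₁ ^ 2 - E₂ ^ 2 = θ * w ^ 2 * (1 - 5 / 4 * θ) := by rw [hE₁def, hE₂def]; ring
  have hE₁w : E₁ ≤ w := by rw [hE₁def]; nlinarith
  set N := (hermitianWilsonDirac (fundamentalRep (Fin 3)) U m₀ 1).charpoly.roots.countP
    (fun z => |z.re| < w) with hNdef
  set N₁ := (hermitianWilsonDirac (fundamentalRep (Fin 3)) U m₀ 1).charpoly.roots.countP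
    (fun z => |z.re| < E₁) with hN₁def
  have hN : (N₁ : ℝ) ≤ N := by exact_mod_cast WindowModes.countP_abs_re_lt_mono _ hE₁w
  -- the block side `r = ⌈400/(√θ w)⌉`
  have hsθ : Real.sqrt θ ^ 2 = θ := Real.sq_sqrt hθ.le
  have hsw0 : 0 < Real.sqrt θ * w := mul_pos (Real.sqrt_pos.mpr hθ) hw
  have hsw1 : Real.sqrt θ * w ≤ 1 := by
    have : Real.sqrt θ ≤ 1 := by
      rw [← Real.sqrt_one]; exact Real.sqrt_le_sqrt (by linarith)
    nlinarith [Real.sqrt_nonneg θ]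
  set r : ℕ := ⌈400 / (Real.sqrt θ * w)⌉₊ with hrdef
  have hr1 : 400 / (Real.sqrt θ * w) ≤ r := Nat.le_ceil _
  have hr2 : (r : ℝ) < 400 / (Real.sqrt θ * w) + 1 := Nat.ceil_lt_add_one (by positivity)
  have hrlo : 400 ≤ (r : ℝ) * (Real.sqrt θ * w) := by
    have := mul_le_mul_of_nonneg_right hr1 hsw0.le
    rwa [div_mul_cancel₀ _ hsw0.ne'] at this
  have hrhi : (r : ℝ) * (Real.sqrt θ * w) ≤ 401 := by
    have h := mul_lt_mul_of_pos_right hr2 hsw0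
    rw [add_mul, div_mul_cancel₀ _ hsw0.ne', one_mul] at h
    linarith
  have hr0' : (0 : ℝ) < r := by nlinarith
  have hr0 : 0 < r := by exact_mod_cast hr0'
  have hrsq : 160000 ≤ (r : ℝ) ^ 2 * (θ * w ^ 2) := by
    have := pow_le_pow_left₀ (by norm_num) hrlo 2
    rw [mul_pow, mul_pow, hsθ] at this
    linarith
  have hrsq' : (r : ℝ) ^ 2 * (θ * w ^ 2) ≤ 401 ^ 2 := by
    have := pow_le_pow_left₀ (by positivity) hrhi 2
    rw [mul_pow, mul_pow, hsθ] at this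
    linarith
  have hr4 : (r : ℝ) ^ 4 ≤ 401 ^ 4 / (θ ^ 2 * w ^ 4) := by
    rw [le_div_iff₀ (by positivity)]
    calc (r : ℝ) ^ 4 * (θ ^ 2 * w ^ 4) = ((r : ℝ) ^ 2 * (θ * w ^ 2)) ^ 2 := by ring
      _ ≤ (401 ^ 2) ^ 2 := pow_le_pow_left₀ (by positivity) hrsq' 2
      _ = 401 ^ 4 := by norm_num
  -- the numerical gap for `D = 8/r²`
  have hgapD : 8 / (r : ℝ) ^ 2 * (96 + 96 ^ 2) ≤ E₁ ^ 2 - E₂ ^ 2 := by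
    rw [hE12, div_mul_eq_mul_div, div_le_iff₀ (by positivity)]
    have hX : 0 ≤ (1 / 3 - θ) * ((r : ℝ) ^ 2 * (θ * w ^ 2)) :=
      mul_nonneg (by linarith) (by positivity)
    nlinarith
  have hgap0 : 0 * (96 + 96 ^ 2) ≤ E₁ ^ 2 - E₂ ^ 2 := by
    rw [zero_mul, hE12]
    exact mul_nonneg (by positivity) (by linarith)
  -- the well set, from the assembly `…Aux5` on the torus patch system or on the single patch
  obtain ⟨R, hcard, hdec⟩ : ∃ R : Finset (TorusSite 4 (2 * S + 1)),
      (R.card : ℝ) ≤ 9 ^ 4 * (4 * (r : ℝ)) ^ 4 * N₁ ∧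
      ∀ (lam : ℝ) (ψ : Idx (2 * S + 1) 3 → ℂ), |lam| ≤ E₀ →
        hermitianWilsonDirac (fundamentalRep (Fin 3)) U m₀ 1 *ᵥ ψ = (lam : ℂ) • ψ →
        ∀ d : ℕ, ∑ p ∈ Finset.univ.filter (fun p : Idx (2 * S + 1) 3 => ∀ x ∈ R, d ≤ torusTaxiDist p.1 x),
          ‖ψ p‖ ^ 2 ≤ 300 * Real.exp (-((E₂ - E₀) / 384 * d)) * ∑ p, ‖ψ p‖ ^ 2 := by
    by_cases hn : 2 ≤ (2 * S + 1) / r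
    · -- the torus patch system with `n = ⌊(2S+1)/r⌋ ≥ 2` blocks per direction
      set n := (2 * S + 1) / r with hndef
      haveI : NeZero n := ⟨by omega⟩
      have hnr : n * r ≤ 2 * S + 1 := Nat.div_mul_le_self _ _
      have hL : 2 * S + 1 < (n + 1) * r := by
        have := Nat.lt_div_mul_add (a := 2 * S + 1) hr0
        rw [← hndef] at this
        calc 2 * S + 1 < n * r + r := this
          _ = (n + 1) * r := by ring
      obtain ⟨χ, Bplus, Close, h1, h2, h3, h4, h5, h6, h7, h8⟩ :=
        WindowModes.stub_windowModesLocalisedAux3 (2 * S + 1) r n hr0 hn hnr hL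
      obtain ⟨R, hc, hd⟩ := WindowModes.stub_windowModesLocalisedAux5 hW1 hW2 U m₀ χ Bplus Close (9 ^ 4)
        ((4 * r) ^ 4) (8 / (r : ℝ) ^ 2) (by positivity) h1 h2 h3 h4 h5 h6 h7 h8 E₁ E₂ E₀ hE₁ hE₀ hE₀₂
        hE₂1 hgapD
      exact ⟨R, by exact_mod_cast hc, hd⟩
    · -- a single patch: the whole (small) torus
      have hLr : 2 * S + 1 < 2 * r := (Nat.div_lt_iff_lt_mul hr0).mp (by omega)
      obtain ⟨R, hc, hd⟩ := WindowModes.stub_windowModesLocalisedAux5 hW1 hW2 U m₀ (𝒥 := Unit)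
        (fun _ _ => (1 : ℝ)) (fun _ => (Finset.univ : Finset (TorusSite 4 (2 * S + 1)))) (fun _ _ => True)
        1 (Fintype.card (TorusSite 4 (2 * S + 1))) 0 le_rfl (by simp) (by simp) (by simp) (by simp)
        (by simp) (by simp) (by simp) (by simp) E₁ E₂ E₀ hE₁ hE₀ hE₀₂ hE₂1 hgap0
      refine ⟨R, ?_, hd⟩
      have hcardT : Fintype.card (TorusSite 4 (2 * S + 1)) = (2 * S + 1) ^ 4 := by
        rw [Fintype.card_pi]; simp [ZMod.card]
      rw [hcardT] at hc
      have hc' : (R.card : ℝ) ≤ 1 * ((2 * S + 1 : ℕ) : ℝ) ^ 4 * N₁ := by exact_mod_cast hc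
      have hL4 : ((2 * S + 1 : ℕ) : ℝ) ^ 4 ≤ (2 * (r : ℝ)) ^ 4 :=
        pow_le_pow_left₀ (by positivity) (by exact_mod_cast hLr.le) 4
      have hN₁0 : (0 : ℝ) ≤ N₁ := by positivity
      calc (R.card : ℝ) ≤ 1 * ((2 * S + 1 : ℕ) : ℝ) ^ 4 * N₁ := hc'
        _ ≤ 1 * (2 * (r : ℝ)) ^ 4 * N₁ := by gcongr
        _ ≤ _ := by nlinarith [mul_nonneg (pow_nonneg hr0'.le 4) hN₁0]
  -- conclusion
  refine ⟨R, ?_, fun lam ψ hlam heig d => ?_⟩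
  · calc (R.card : ℝ) ≤ 9 ^ 4 * (4 * (r : ℝ)) ^ 4 * N₁ := hcard
      _ = 9 ^ 4 * 4 ^ 4 * (r : ℝ) ^ 4 * N₁ := by ring
      _ ≤ 9 ^ 4 * 4 ^ 4 * (401 ^ 4 / (θ ^ 2 * w ^ 4)) * N := by
          apply mul_le_mul _ hN (by positivity) (by positivity)
          exact mul_le_mul_of_nonneg_left hr4 (by positivity)
      _ = _ := by ring
  · have hS0 : 0 ≤ ∑ p, ‖ψ p‖ ^ 2 := Finset.sum_nonneg fun p _ => by positivity
    have hexp : Real.exp (-((E₂ - E₀) / 384 * (d : ℝ))) = Real.exp (-(1 / 768 * θ * w * (d : ℝ))) := by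
      rw [hE20]; congr 1; ring
    calc _ ≤ 300 * Real.exp (-((E₂ - E₀) / 384 * d)) * ∑ p, ‖ψ p‖ ^ 2 := hdec lam ψ hlam heig d
      _ = 300 * (Real.exp (-(1 / 768 * θ * w * (d : ℝ))) * ∑ p, ‖ψ p‖ ^ 2) := by rw [hexp, mul_assoc]
      _ ≤ (9 : ℝ) ^ 4 * 4 ^ 4 * 401 ^ 4 * (Real.exp (-(1 / 768 * θ * w * (d : ℝ))) * ∑ p, ‖ψ p‖ ^ 2) :=
          mul_le_mul_of_nonneg_right (by norm_num) (mul_nonneg (Real.exp_pos _).le hS0)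
      _ = _ := by ring

end Summit.QuantumFields.QCD.Cruxes.ExtinctionBuildsQCD.BlockAwayTheSign

end
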